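import Literature.NumberTheory.Sieve.PolynomialValuesSieveBounds
import Literature.NumberTheory.Sieve.SieveFrameworkUpperBound
import HarnessLib

/-!
# The two-dimensional upper-bound sieve for a pair of linear forms

Topic `Literature/NumberTheory/Sieve`. Everything in this file is PROVED; no definition is
introduced. For two integral linear forms `ℓ₁(t) = α₁t + β₁`, `ℓ₂(t) = α₂t + β₂`, positive on
`1 ≤ t ≤ T`, and an ODD squarefree sifting range `P ∣ P(w)` at whose primes neither form vanishes
identically, the number of `t ≤ T` with `(ℓ₁(t)ℓ₂(t), P) = 1` is

`≤ C₀ T ∏_{p ∣ P} (1 − ρ(p)/p) + C₀ w^{19} log² w`, `ρ(p) = #{t mod p : ℓ₁(t)ℓ₂(t) ≡ 0}`,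

with an absolute `C₀` (`PairLinSieve.card_coprime_le`), together with the form used for
"Brun–Titchmarsh" purposes (`PairLinSieve.card_coprime_le_of_generic`): if `ρ(p) = 2` off the
prime divisors of an auxiliary `E` and `ρ(p) ≥ 1` on them, the main term is
`C₀ T ∏_{p ∣ P}(1 − 2/p) ∏_{p ∣ P, p ∣ E} (p−1)/(p−2)`.

This is the counting engine of Nair–Tenenbaum / Henriot type bounds for a pair of linear forms
(`n`, `mn + h`), cf. Matomäki–Merikoski, arXiv:2112.11412, Lemma 3.1, there deduced from
Henriot's theorem. The proof is the tree's beta-sieve upper bound for a general sifting set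
(`SieveSequence.sifted_le_of_dvd_primesProdBelow`) applied to the polynomial sequence
(`polyAPSeq`) of a modified polynomial `F♭ = pp(ℓ₁ℓ₂ + Pκ)`, `κ = 1 + |F(0)F(1)|`: adding the odd
constant `Pκ` does not change the values modulo `P` but makes `ω(2) ≤ 1`, and passing to the
primitive part makes `ω(p) ≤ 2` at every prime, so that the tree's dimension-`2` density bound
`hasSieveDimension_rootDensity` and remainder bound `sum_rootCount_divisors_le` apply verbatim.

## References

* H. Halberstam, H.-E. Richert, *Sieve Methods* (1974), Thm 2.5 and Ch. 1 Example 5.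
  [cite: HalberstamRichert1974, Thm 2.5]
* K. Matomäki, J. Merikoski, IMRN 2023 (arXiv:2112.11412), Lemma 3.1. [cite: MatomakiMerikoski2023, Lemma 3.1]
-/

noncomputable section

open Finset Real Polynomial

namespace Literature.NumberTheory.Sieve

namespace PairLinSieve

/-! ### Root counts modulo a prime -/

/-- A polynomial that is non-zero modulo the prime `p` has at most `deg` roots modulo `p`.
[folklore] -/
theorem rootCount_le_natDegree_of_map_ne_zero {g : ℤ[X]} {p : ℕ} (hp : p.Prime)
    (hg : g.map (Int.castRingHom (ZMod p)) ≠ 0) : polyRootCountMod ![g] p ≤ g.natDegree := by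
  classical
  haveI := Fact.mk hp
  rw [polyRootCountMod_single]
  set g' : (ZMod p)[X] := g.map (Int.castRingHom (ZMod p)) with hg'
  have hev : ∀ n : ℕ, g'.eval (n : ZMod p) = ((g.eval (n : ℤ) : ℤ) : ZMod p) := fun n => by
    rw [hg', ← Int.cast_natCast (R := ZMod p) n, eval_intCast_map, eq_intCast, Int.cast_id]
  calc #((range p).filter fun n : ℕ => (p : ℤ) ∣ g.eval (n : ℤ))
      ≤ #(g'.roots.toFinset) := by
        refine Finset.card_le_card_of_injOn (fun n : ℕ => (n : ZMod p)) ?_ ?_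
        · intro n hn
          rw [mem_coe, mem_filter, mem_range] at hn
          simp only [mem_coe, Multiset.mem_toFinset, mem_roots hg, IsRoot.def]
          rw [hev, ZMod.intCast_zmod_eq_zero_iff_dvd]
          exact hn.2
        · intro m hm n hn hmn
          rw [mem_coe, mem_filter, mem_range] at hm hn
          have := congrArg ZMod.val hmn
          rwa [ZMod.val_natCast_of_lt hm.1, ZMod.val_natCast_of_lt hn.1] at this
    _ ≤ Multiset.card g'.roots := Multiset.toFinset_card_le _
    _ ≤ g'.natDegree := card_roots' _
    _ ≤ g.natDegree := natDegree_map_le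

/-- A primitive integer polynomial is non-zero modulo every prime. [folklore] -/
theorem map_ne_zero_of_isPrimitive {g : ℤ[X]} (hg : g.IsPrimitive) {p : ℕ} (hp : p.Prime) :
    g.map (Int.castRingHom (ZMod p)) ≠ 0 := by
  intro h0
  have hdvd : C (p : ℤ) ∣ g := by
    rw [C_dvd_iff_dvd_coeff]
    intro i
    have hc : (g.map (Int.castRingHom (ZMod p))).coeff i = 0 := by rw [h0, coeff_zero]
    rw [coeff_map, eq_intCast, ZMod.intCast_zmod_eq_zero_iff_dvd] at hc
    exact hc
  have hu := hg (p : ℤ) hdvd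
  rw [Int.isUnit_iff_natAbs_eq, Int.natAbs_natCast] at hu
  exact hp.one_lt.ne' hu

/-- The map modulo `p` of a polynomial all of whose values... : if `p` divides every coefficient of
`g` then `g ≡ 0 (mod p)` as a polynomial, i.e. conversely a polynomial non-zero mod `p` has a
coefficient not divisible by `p`. Here: `g.map = 0 ↔ C p ∣ g`. [folklore] -/
theorem map_eq_zero_iff_C_dvd (g : ℤ[X]) (p : ℕ) :
    g.map (Int.castRingHom (ZMod p)) = 0 ↔ C (p : ℤ) ∣ g := by
  rw [C_dvd_iff_dvd_coeff]
  constructor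
  · intro h0 i
    have hc : (g.map (Int.castRingHom (ZMod p))).coeff i = 0 := by rw [h0, coeff_zero]
    rwa [coeff_map, eq_intCast, ZMod.intCast_zmod_eq_zero_iff_dvd] at hc
  · intro h
    ext i
    rw [coeff_map, eq_intCast, coeff_zero, ZMod.intCast_zmod_eq_zero_iff_dvd]
    exact h i

/-- The roots of a linear form `αt + β` modulo a prime `p ∤ α`: exactly one residue. [folklore] -/
theorem card_filter_dvd_linear_eq_one {α β : ℤ} {p : ℕ} (hp : p.Prime) (hα : ¬ (p : ℤ) ∣ α) :
    #((range p).filter fun n : ℕ => (p : ℤ) ∣ α * n + β) = 1 := by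
  haveI := Fact.mk hp
  have hα0 : (α : ZMod p) ≠ 0 := by rwa [Ne, ZMod.intCast_zmod_eq_zero_iff_dvd]
  set r : ZMod p := -(β : ZMod p) * (α : ZMod p)⁻¹ with hr
  have hset : (range p).filter (fun n : ℕ => (p : ℤ) ∣ α * n + β) = {r.val} := by
    ext n
    simp only [mem_filter, mem_range, mem_singleton]
    have hcast : ((p : ℤ) ∣ α * n + β) ↔ ((α : ZMod p) * (n : ZMod p) + (β : ZMod p) = 0) := by
      rw [← ZMod.intCast_zmod_eq_zero_iff_dvd]
      push_cast
      rfl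
    rw [hcast]
    constructor
    · rintro ⟨hn, h0⟩
      have : (n : ZMod p) = r := by
        rw [hr]
        field_simp
        linear_combination h0
      rw [← this, ZMod.val_natCast_of_lt hn]
    · rintro rfl
      refine ⟨ZMod.val_lt r, ?_⟩
      rw [ZMod.natCast_zmod_val, hr]
      field_simp
      ring
  rw [hset, card_singleton]

/-- A linear form `αt + β` with `p ∣ α`, `p ∤ β` has no root modulo `p`. [folklore] -/
theorem card_filter_dvd_linear_eq_zero {α β : ℤ} {p : ℕ} (hα : (p : ℤ) ∣ α) (hβ : ¬ (p : ℤ) ∣ β) :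
    #((range p).filter fun n : ℕ => (p : ℤ) ∣ α * n + β) = 0 := by
  rw [Finset.card_eq_zero, Finset.filter_eq_empty_iff]
  intro n _ h
  apply hβ
  have : (p : ℤ) ∣ α * n := dvd_mul_of_dvd_left hα _
  exact (dvd_add_right this).mp h

/-- The root count of the product of two linear forms is the size of the union of the two root
sets. [folklore] -/
theorem rootCount_pair_eq (α₁ β₁ α₂ β₂ : ℤ) {p : ℕ} (hp : p.Prime) :
    polyRootCountMod ![(C α₁ * X + C β₁) * (C α₂ * X + C β₂)] p =
      #(((range p).filter fun n : ℕ => (p : ℤ) ∣ α₁ * n + β₁) ∪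
        ((range p).filter fun n : ℕ => (p : ℤ) ∣ α₂ * n + β₂)) := by
  rw [polyRootCountMod_single, ← Finset.filter_or]
  congr 1
  refine Finset.filter_congr fun n _ => ?_
  simp only [eval_mul, eval_add, eval_C, eval_X]
  exact ⟨fun h' => Int.Prime.dvd_mul' hp h', fun h' => h'.elim (fun h1 => dvd_mul_of_dvd_left h1 _)
    (fun h2 => dvd_mul_of_dvd_right h2 _)⟩


/-- Each non-degenerate linear form has at most one root modulo `p`. [folklore] -/
theorem card_filter_dvd_linear_le_one {α β : ℤ} {p : ℕ} (hp : p.Prime)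
    (hnd : ¬ ((p : ℤ) ∣ α ∧ (p : ℤ) ∣ β)) :
    #((range p).filter fun n : ℕ => (p : ℤ) ∣ α * n + β) ≤ 1 := by
  by_cases hα : (p : ℤ) ∣ α
  · rw [card_filter_dvd_linear_eq_zero hα fun hβ => hnd ⟨hα, hβ⟩]
    exact zero_le_one
  · rw [card_filter_dvd_linear_eq_one hp hα]

/-- `ρ(p) ≤ 2` for the product of two non-degenerate linear forms. [folklore] -/
theorem rootCount_pair_le_two {α₁ β₁ α₂ β₂ : ℤ} {p : ℕ} (hp : p.Prime)
    (h₁ : ¬ ((p : ℤ) ∣ α₁ ∧ (p : ℤ) ∣ β₁)) (h₂ : ¬ ((p : ℤ) ∣ α₂ ∧ (p : ℤ) ∣ β₂)) :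
    polyRootCountMod ![(C α₁ * X + C β₁) * (C α₂ * X + C β₂)] p ≤ 2 := by
  rw [rootCount_pair_eq α₁ β₁ α₂ β₂ hp]
  calc _ ≤ #((range p).filter fun n : ℕ => (p : ℤ) ∣ α₁ * n + β₁) +
        #((range p).filter fun n : ℕ => (p : ℤ) ∣ α₂ * n + β₂) := Finset.card_union_le _ _
    _ ≤ 1 + 1 := Nat.add_le_add (card_filter_dvd_linear_le_one hp h₁)
        (card_filter_dvd_linear_le_one hp h₂)

/-- `ρ(p) ≥ 1` as soon as one of the two (non-degenerate) forms has an invertible slope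
modulo `p`. [folklore] -/
theorem one_le_rootCount_pair {α₁ β₁ α₂ β₂ : ℤ} {p : ℕ} (hp : p.Prime)
    (h : ¬ ((p : ℤ) ∣ α₁ ∧ (p : ℤ) ∣ α₂)) :
    1 ≤ polyRootCountMod ![(C α₁ * X + C β₁) * (C α₂ * X + C β₂)] p := by
  rw [rootCount_pair_eq α₁ β₁ α₂ β₂ hp]
  by_cases hα : (p : ℤ) ∣ α₁
  · have hα₂ : ¬ (p : ℤ) ∣ α₂ := fun h' => h ⟨hα, h'⟩
    calc 1 = #((range p).filter fun n : ℕ => (p : ℤ) ∣ α₂ * n + β₂) :=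
          (card_filter_dvd_linear_eq_one hp hα₂).symm
      _ ≤ _ := Finset.card_le_card Finset.subset_union_right
  · calc 1 = #((range p).filter fun n : ℕ => (p : ℤ) ∣ α₁ * n + β₁) :=
          (card_filter_dvd_linear_eq_one hp hα).symm
      _ ≤ _ := Finset.card_le_card Finset.subset_union_left

/-- `ρ(p) = 2` in the generic case: both slopes invertible and the two roots distinct
(`p ∤ α₁β₂ − α₂β₁`). [folklore] -/
theorem rootCount_pair_eq_two {α₁ β₁ α₂ β₂ : ℤ} {p : ℕ} (hp : p.Prime)
    (hα₁ : ¬ (p : ℤ) ∣ α₁) (hα₂ : ¬ (p : ℤ) ∣ α₂) (hres : ¬ (p : ℤ) ∣ α₁ * β₂ - α₂ * β₁) :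
    polyRootCountMod ![(C α₁ * X + C β₁) * (C α₂ * X + C β₂)] p = 2 := by
  haveI := Fact.mk hp
  rw [rootCount_pair_eq α₁ β₁ α₂ β₂ hp]
  set A := (range p).filter fun n : ℕ => (p : ℤ) ∣ α₁ * n + β₁ with hA
  set B := (range p).filter fun n : ℕ => (p : ℤ) ∣ α₂ * n + β₂ with hB
  have hA1 : #A = 1 := card_filter_dvd_linear_eq_one hp hα₁
  have hB1 : #B = 1 := card_filter_dvd_linear_eq_one hp hα₂
  have hdisj : Disjoint A B := by
    rw [Finset.disjoint_left]
    intro n hnA hnB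
    rw [hA, mem_filter] at hnA
    rw [hB, mem_filter] at hnB
    apply hres
    -- `α₁β₂ − α₂β₁ = α₁(α₂ n + β₂) − α₂(α₁ n + β₁)`
    have : α₁ * β₂ - α₂ * β₁ = α₁ * (α₂ * n + β₂) - α₂ * (α₁ * n + β₁) := by ring
    rw [this]
    exact dvd_sub (dvd_mul_of_dvd_right hnB.2 _) (dvd_mul_of_dvd_right hnA.2 _)
  rw [Finset.card_union_of_disjoint hdisj, hA1, hB1]

/-! ### Changing the polynomial without changing the values modulo `P` -/

/-- Polynomials with the same zero set modulo `p` have the same root count. [folklore] -/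
theorem rootCount_congr {F G : ℤ[X]} {p : ℕ}
    (h : ∀ n : ℕ, (p : ℤ) ∣ F.eval (n : ℤ) ↔ (p : ℤ) ∣ G.eval (n : ℤ)) :
    polyRootCountMod ![F] p = polyRootCountMod ![G] p := by
  rw [polyRootCountMod_single, polyRootCountMod_single]
  exact congrArg Finset.card (Finset.filter_congr fun n _ => h n)

/-- Adding a constant divisible by `p` does not change divisibility of the values by `p`.
[folklore] -/
theorem dvd_eval_add_C_iff {F : ℤ[X]} {c : ℤ} {p : ℤ} (hc : p ∣ c) (n : ℤ) :
    p ∣ (F + C c).eval n ↔ p ∣ F.eval n := by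
  rw [eval_add, eval_C]
  exact dvd_add_left hc

/-- Dividing out a constant coprime to `p` does not change divisibility of the values by the
prime `p`. [folklore] -/
theorem dvd_eval_C_mul_iff {G : ℤ[X]} {c : ℤ} {p : ℕ} (hp : p.Prime) (hc : ¬ (p : ℤ) ∣ c)
    (n : ℤ) : (p : ℤ) ∣ (C c * G).eval n ↔ (p : ℤ) ∣ G.eval n := by
  rw [eval_mul, eval_C]
  constructor
  · intro h
    exact ((Int.Prime.dvd_mul' hp h).resolve_left hc)
  · intro h
    exact dvd_mul_of_dvd_right h _

/-- **The parity trick.** For `F ∈ ℤ[X]`, `P` odd and `κ = 1 + |F(0)F(1)|`, the polynomial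
`F♯ = F + Pκ` takes an odd value at `0` or at `1`; hence `ω_{F♯}(2) ≤ 1`. [folklore] -/
theorem rootCount_two_add_C_le_one (F : ℤ[X]) {P : ℕ} (hP : Odd P) :
    polyRootCountMod ![F + C ((P : ℤ) * (1 + ((F.eval 0 * F.eval 1).natAbs : ℤ)))] 2 ≤ 1 := by
  rw [polyRootCountMod_single]
  set a : ℤ := F.eval 0 with ha
  set b : ℤ := F.eval 1 with hb
  set c : ℤ := (P : ℤ) * (1 + ((a * b).natAbs : ℤ)) with hc
  by_contra hlt
  push Not at hlt
  -- both residues are roots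
  have hall : (range 2).filter (fun n : ℕ => ((2 : ℕ) : ℤ) ∣ (F + C c).eval (n : ℤ)) = range 2 := by
    apply Finset.eq_of_subset_of_card_le (Finset.filter_subset _ _)
    rw [Finset.card_range]
    exact hlt
  have h0 : (2 : ℤ) ∣ a + c := by
    have : (0 : ℕ) ∈ (range 2).filter (fun n : ℕ => ((2 : ℕ) : ℤ) ∣ (F + C c).eval (n : ℤ)) := by
      rw [hall]; simp
    rw [mem_filter] at this
    simpa [eval_add, eval_C, ha] using this.2
  have h1 : (2 : ℤ) ∣ b + c := by
    have : (1 : ℕ) ∈ (range 2).filter (fun n : ℕ => ((2 : ℕ) : ℤ) ∣ (F + C c).eval (n : ℤ)) := by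
      rw [hall]; simp
    rw [mem_filter] at this
    simpa [eval_add, eval_C, hb] using this.2
  have hPodd : Odd (P : ℤ) := by exact_mod_cast hP
  have hκ : Even (1 + ((a * b).natAbs : ℤ)) ↔ (Odd a ∧ Odd b) := by
    rw [add_comm, Int.even_add_one, Int.even_coe_nat, Int.natAbs_even, Int.not_even_iff_odd,
      Int.odd_mul]
  have hceven : Even c ↔ (Odd a ∧ Odd b) := by
    rw [hc, Int.even_mul, ← hκ, or_iff_right (Int.not_even_iff_odd.mpr hPodd)]
  rw [← even_iff_two_dvd, Int.even_add] at h0 h1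
  by_cases hce : Even c
  · have hab := hceven.mp hce
    exact (Int.not_even_iff_odd.mpr hab.1) (h0.mpr hce)
  · have ha' : ¬ Even a := fun h => hce (h0.mp h)
    have hb' : ¬ Even b := fun h => hce (h1.mp h)
    exact hce (hceven.mpr ⟨Int.not_even_iff_odd.mp ha', Int.not_even_iff_odd.mp hb'⟩)


/-- `ω_G(2) ≤ 1` as soon as `G(0)` and `G(1)` are not both even. [folklore] -/
theorem rootCount_two_le_one_of {G : ℤ[X]}
    (h : ¬ ((2 : ℤ) ∣ G.eval 0 ∧ (2 : ℤ) ∣ G.eval 1)) : polyRootCountMod ![G] 2 ≤ 1 := by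
  rw [polyRootCountMod_single]
  by_contra hlt
  push Not at hlt
  have hall : (range 2).filter (fun n : ℕ => ((2 : ℕ) : ℤ) ∣ G.eval (n : ℤ)) = range 2 := by
    apply Finset.eq_of_subset_of_card_le (Finset.filter_subset _ _)
    rw [Finset.card_range]
    exact hlt
  apply h
  constructor
  · have : (0 : ℕ) ∈ (range 2).filter (fun n : ℕ => ((2 : ℕ) : ℤ) ∣ G.eval (n : ℤ)) := by
      rw [hall]; simp
    simpa using (mem_filter.mp this).2
  · have : (1 : ℕ) ∈ (range 2).filter (fun n : ℕ => ((2 : ℕ) : ℤ) ∣ G.eval (n : ℤ)) := by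
      rw [hall]; simp
    simpa using (mem_filter.mp this).2

/-- **The parity trick, value form.** `F(0) + Pκ` and `F(1) + Pκ` are not both even when `P` is odd
and `κ = 1 + |F(0)F(1)|`. [folklore] -/
theorem not_two_dvd_both (F : ℤ[X]) {P : ℕ} (hP : Odd P) :
    ¬ ((2 : ℤ) ∣ (F + C ((P : ℤ) * (1 + ((F.eval 0 * F.eval 1).natAbs : ℤ)))).eval 0 ∧
       (2 : ℤ) ∣ (F + C ((P : ℤ) * (1 + ((F.eval 0 * F.eval 1).natAbs : ℤ)))).eval 1) := by
  intro h
  have := rootCount_two_add_C_le_one F hP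
  rw [polyRootCountMod_single] at this
  have h2 : 2 ≤ #((range 2).filter fun n : ℕ =>
      ((2 : ℕ) : ℤ) ∣ (F + C ((P : ℤ) * (1 + ((F.eval 0 * F.eval 1).natAbs : ℤ)))).eval (n : ℤ)) := by
    have hsub : ({0, 1} : Finset ℕ) ⊆ (range 2).filter fun n : ℕ =>
        ((2 : ℕ) : ℤ) ∣ (F + C ((P : ℤ) * (1 + ((F.eval 0 * F.eval 1).natAbs : ℤ)))).eval (n : ℤ) := by
      intro n hn
      simp only [Finset.mem_insert, Finset.mem_singleton] at hn
      rw [mem_filter, mem_range]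
      rcases hn with rfl | rfl
      · exact ⟨by norm_num, by simpa using h.1⟩
      · exact ⟨by norm_num, by simpa using h.2⟩
    calc 2 = #({0, 1} : Finset ℕ) := by rfl
      _ ≤ _ := Finset.card_le_card hsub
  omega

/-! ### Content and primitive part -/

/-- The content of a non-zero integer polynomial is positive. [folklore] -/
theorem content_pos_of_ne_zero {G : ℤ[X]} (hG : G ≠ 0) : 0 < G.content := by
  have hne : G.content ≠ 0 := fun h => hG (content_eq_zero_iff.mp h)
  have hnn : 0 ≤ G.content := by
    rw [← normalize_content, ← Int.abs_eq_normalize]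
    exact abs_nonneg _
  exact lt_of_le_of_ne hnn (Ne.symm hne)

/-- `G(t) = cont(G) · pp(G)(t)`. [folklore] -/
theorem eval_eq_content_mul_eval_primPart (G : ℤ[X]) (t : ℤ) :
    G.eval t = G.content * G.primPart.eval t := by
  conv_lhs => rw [G.eq_C_content_mul_primPart]
  rw [eval_mul, eval_C]

/-- The degree of `ℓ₁ℓ₂ + c` is at most `2`. [folklore] -/
theorem natDegree_pair_add_C_le (α₁ β₁ α₂ β₂ c : ℤ) :
    ((C α₁ * X + C β₁) * (C α₂ * X + C β₂) + C c).natDegree ≤ 2 := by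
  refine (natDegree_add_le _ _).trans (max_le ?_ (by simp))
  refine (natDegree_mul_le).trans ?_
  have h1 := natDegree_linear_le (a := α₁) (b := β₁)
  have h2 := natDegree_linear_le (a := α₂) (b := β₂)
  omega

/-- A linear form that vanishes identically modulo the prime `p` has both coefficients divisible
by `p`. [folklore] -/
theorem dvd_and_dvd_of_map_linear_eq_zero {α β : ℤ} {p : ℕ}
    (h : (C α * X + C β : ℤ[X]).map (Int.castRingHom (ZMod p)) = 0) :
    (p : ℤ) ∣ α ∧ (p : ℤ) ∣ β := by
  have hc1 : ((C α * X + C β : ℤ[X]).map (Int.castRingHom (ZMod p))).coeff 1 = 0 := by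
    rw [h, coeff_zero]
  have hc0 : ((C α * X + C β : ℤ[X]).map (Int.castRingHom (ZMod p))).coeff 0 = 0 := by
    rw [h, coeff_zero]
  rw [coeff_map] at hc1 hc0
  simp only [coeff_add, coeff_C_mul_X, coeff_C, if_true] at hc1 hc0
  norm_num at hc1 hc0
  rw [ZMod.intCast_zmod_eq_zero_iff_dvd] at hc1 hc0
  exact ⟨hc1, hc0⟩

/-- If neither linear form vanishes identically modulo the prime `p` and `p ∣ c`, then `p` does
not divide the content of `ℓ₁ℓ₂ + c` (otherwise `ℓ₁ℓ₂ ≡ 0 (mod p)` in the domain `𝔽_p[t]`).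
[folklore] -/
theorem not_dvd_content {α₁ β₁ α₂ β₂ c : ℤ} {p : ℕ} (hp : p.Prime) (hc : (p : ℤ) ∣ c)
    (h₁ : ¬ ((p : ℤ) ∣ α₁ ∧ (p : ℤ) ∣ β₁)) (h₂ : ¬ ((p : ℤ) ∣ α₂ ∧ (p : ℤ) ∣ β₂)) :
    ¬ (p : ℤ) ∣ ((C α₁ * X + C β₁) * (C α₂ * X + C β₂) + C c).content := by
  haveI := Fact.mk hp
  intro hdvd
  -- `p` divides every coefficient, so the polynomial vanishes mod `p`
  have hmap : ((C α₁ * X + C β₁) * (C α₂ * X + C β₂) + C c : ℤ[X]).map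
      (Int.castRingHom (ZMod p)) = 0 := by
    rw [map_eq_zero_iff_C_dvd]
    exact (C_dvd_iff_dvd_coeff _ _).mpr fun i => hdvd.trans (content_dvd_coeff i)
  have hcmap : (C c : ℤ[X]).map (Int.castRingHom (ZMod p)) = 0 := by
    rw [Polynomial.map_C, eq_intCast, (ZMod.intCast_zmod_eq_zero_iff_dvd c p).mpr hc, C_0]
  have hprod : ((C α₁ * X + C β₁ : ℤ[X]).map (Int.castRingHom (ZMod p))) *
      ((C α₂ * X + C β₂ : ℤ[X]).map (Int.castRingHom (ZMod p))) = 0 := by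
    rw [← Polynomial.map_mul]
    have := hmap
    rw [Polynomial.map_add, hcmap, add_zero] at this
    exact this
  rcases mul_eq_zero.mp hprod with h | h
  · exact h₁ (dvd_and_dvd_of_map_linear_eq_zero h)
  · exact h₂ (dvd_and_dvd_of_map_linear_eq_zero h)


/-- Transfer of coprimality with `P` between two integers having the same prime divisors among
the primes of `P`. [folklore] -/
theorem natAbs_coprime_iff_of_forall {a b : ℤ} {P : ℕ}
    (h : ∀ p : ℕ, p.Prime → p ∣ P → ((p : ℤ) ∣ a ↔ (p : ℤ) ∣ b)) :
    a.natAbs.Coprime P ↔ b.natAbs.Coprime P := by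
  constructor
  · intro ha
    refine Nat.coprime_of_dvd fun k hk hkb hkP => ?_
    have hka : k ∣ a.natAbs := Int.ofNat_dvd_left.mp ((h k hk hkP).mpr (Int.ofNat_dvd_left.mpr hkb))
    have := Nat.dvd_gcd hka hkP
    rw [ha.gcd_eq_one] at this
    exact hk.one_lt.ne' (Nat.dvd_one.mp this)
  · intro hb
    refine Nat.coprime_of_dvd fun k hk hka hkP => ?_
    have hkb : k ∣ b.natAbs := Int.ofNat_dvd_left.mp ((h k hk hkP).mp (Int.ofNat_dvd_left.mpr hka))
    have := Nat.dvd_gcd hkb hkP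
    rw [hb.gcd_eq_one] at this
    exact hk.one_lt.ne' (Nat.dvd_one.mp this)

/-! ### The sieve bound -/

/-- **The two-dimensional upper-bound sieve for a pair of linear forms.** There is an absolute
`C₀ > 0` such that for all integers `α₁, β₁, α₂, β₂`, every `T`, every `w ≥ 2` and every ODD
squarefree `P ∣ P(w)` such that neither form `αᵢ t + βᵢ` vanishes identically modulo a prime of
`P`, and both forms are positive on `1 ≤ t ≤ T`,
`#{1 ≤ t ≤ T : ((α₁t+β₁)(α₂t+β₂), P) = 1} ≤ C₀ T ∏_{p ∣ P} (1 − ρ(p)/p) + C₀ w^{19} log² w`,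
where `ρ(p) = ω_{ℓ₁ℓ₂}(p)` is the number of roots of `(α₁t+β₁)(α₂t+β₂)` modulo `p`.
(Halberstam–Richert Thm 2.5 / the beta-sieve upper bound of level `D = w^{19}` in dimension `2`,
for the polynomial sequence of `pp(ℓ₁ℓ₂ + Pκ)`.) [cite: HalberstamRichert1974, Thm 2.5] -/
theorem card_coprime_le :
    ∃ C₀ : ℝ, 0 < C₀ ∧ ∀ (α₁ β₁ α₂ β₂ : ℤ) (T : ℕ) (w : ℝ) (P : ℕ), 2 ≤ w →
      P ∣ primesProdBelow w → Odd P →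
      (∀ p ∈ P.primeFactors, ¬ ((p : ℤ) ∣ α₁ ∧ (p : ℤ) ∣ β₁)) →
      (∀ p ∈ P.primeFactors, ¬ ((p : ℤ) ∣ α₂ ∧ (p : ℤ) ∣ β₂)) →
      (∀ t : ℕ, 1 ≤ t → t ≤ T → 0 < α₁ * t + β₁ ∧ 0 < α₂ * t + β₂) →
      (#((Icc 1 T).filter fun t : ℕ =>
          ((α₁ * t + β₁) * (α₂ * t + β₂)).natAbs.Coprime P) : ℝ) ≤
        C₀ * T * ∏ p ∈ P.primeFactors,
            (1 - (polyRootCountMod ![(C α₁ * X + C β₁) * (C α₂ * X + C β₂)] p : ℝ) / p) +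
          C₀ * w ^ (19 : ℕ) * Real.log w ^ 2 := by
  set K : ℝ := 2 * Real.exp (17 + 12 / Real.log 2) with hK
  have hK0 : 0 ≤ K := by positivity
  refine ⟨1 + 2 * K ^ (10 : ℕ) + Real.exp 8, by positivity, ?_⟩
  intro α₁ β₁ α₂ β₂ T w P hw hPw hPodd hnd₁ hnd₂ hpos
  set F : ℤ[X] := (C α₁ * X + C β₁) * (C α₂ * X + C β₂) with hF
  have hFeval : ∀ t : ℤ, F.eval t = (α₁ * t + β₁) * (α₂ * t + β₂) := fun t => by
    simp [hF, eval_mul, eval_add, eval_X]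
  set V : ℝ := ∏ p ∈ P.primeFactors, (1 - (polyRootCountMod ![F] p : ℝ) / p) with hV
  -- the primes of `P` are odd primes
  have hPne : P ≠ 0 := by rintro rfl; exact (Nat.not_odd_zero hPodd).elim
  have hprimeP : ∀ p ∈ P.primeFactors, p.Prime ∧ p ∣ P ∧ (3 : ℝ) ≤ p := by
    intro p hp
    have hpp := Nat.prime_of_mem_primeFactors hp
    have hpd := Nat.dvd_of_mem_primeFactors hp
    refine ⟨hpp, hpd, ?_⟩
    have h2 : p ≠ 2 := by
      rintro rfl
      exact (Nat.not_even_iff_odd.mpr hPodd) (even_iff_two_dvd.mpr hpd)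
    exact_mod_cast (Nat.succ_le_of_lt (lt_of_le_of_ne hpp.two_le (Ne.symm h2)))
  have hV0 : 0 ≤ V := by
    refine Finset.prod_nonneg fun p hp => ?_
    obtain ⟨hpp, -, hp3⟩ := hprimeP p hp
    have hρ : (polyRootCountMod ![F] p : ℝ) ≤ 2 := by
      exact_mod_cast rootCount_pair_le_two hpp (hnd₁ p hp) (hnd₂ p hp)
    have hp0 : (0 : ℝ) < p := by linarith
    rw [sub_nonneg, div_le_one hp0]
    linarith
  have hw0 : (0 : ℝ) < w := by linarith
  have hlogw : 0 < Real.log w := Real.log_pos (by linarith)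
  have herr0 : 0 ≤ w ^ (19 : ℕ) * Real.log w ^ 2 := by positivity
  -- the case `T = 0`
  rcases Nat.eq_zero_or_pos T with rfl | hT
  · have : (Icc 1 0 : Finset ℕ) = ∅ := by decide
    rw [this, Finset.filter_empty, Finset.card_empty, Nat.cast_zero]
    have := mul_nonneg (by positivity : (0 : ℝ) ≤ 1 + 2 * K ^ (10 : ℕ) + Real.exp 8) herr0
    nlinarith [hV0]
  -- the modified polynomial
  set c : ℤ := (P : ℤ) * (1 + ((F.eval 0 * F.eval 1).natAbs : ℤ)) with hc
  have hPc : (P : ℤ) ∣ c := Dvd.intro _ rfl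
  have hc0 : 0 < c := by
    have hP1 : (1 : ℤ) ≤ P := by exact_mod_cast Nat.pos_of_ne_zero hPne
    rw [hc]; positivity
  set Fs : ℤ[X] := F + C c with hFs
  have hFs_eval : ∀ t : ℤ, Fs.eval t = F.eval t + c := fun t => by rw [hFs, eval_add, eval_C]
  have hFs_pos : ∀ t : ℕ, 1 ≤ t → t ≤ T → 0 < Fs.eval (t : ℤ) := by
    intro t ht1 ht2
    rw [hFs_eval, hFeval]
    have := hpos t ht1 ht2
    nlinarith [this.1, this.2]
  have hFs_ne : Fs ≠ 0 := by
    intro h0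
    have := hFs_pos 1 le_rfl hT
    rw [h0, eval_zero] at this
    exact lt_irrefl _ this
  have hcont : 0 < Fs.content := content_pos_of_ne_zero hFs_ne
  set Fb : ℤ[X] := Fs.primPart with hFb
  have hFb_eval : ∀ t : ℤ, Fs.eval t = Fs.content * Fb.eval t :=
    fun t => eval_eq_content_mul_eval_primPart Fs t
  have hFb_pos : ∀ t : ℕ, 1 ≤ t → t ≤ T → 0 < Fb.eval (t : ℤ) := by
    intro t ht1 ht2
    have := hFs_pos t ht1 ht2
    rw [hFb_eval] at this
    exact pos_of_mul_pos_right this hcont.le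
  -- root counts of `Fb`
  have hωle : ∀ p : ℕ, p.Prime → polyRootCountMod ![Fb] p ≤ 2 := by
    intro p hp
    refine (rootCount_le_natDegree_of_map_ne_zero hp
      (map_ne_zero_of_isPrimitive (isPrimitive_primPart Fs) hp)).trans ?_
    rw [natDegree_primPart]
    exact natDegree_pair_add_C_le α₁ β₁ α₂ β₂ c
  have hω2 : polyRootCountMod ![Fb] 2 ≤ 1 := by
    refine rootCount_two_le_one_of fun h => not_two_dvd_both F hPodd ?_
    rw [← hc, ← hFs, hFb_eval 0, hFb_eval 1]
    exact ⟨dvd_mul_of_dvd_right h.1 _, dvd_mul_of_dvd_right h.2 _⟩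
  -- transfer of divisibility at the primes of `P`
  have htrans : ∀ p : ℕ, p.Prime → p ∣ P → ∀ t : ℤ, ((p : ℤ) ∣ F.eval t ↔ (p : ℤ) ∣ Fb.eval t) := by
    intro p hp hpP t
    have hpc : (p : ℤ) ∣ c := (Int.natCast_dvd_natCast.mpr hpP).trans hPc
    have hmem : p ∈ P.primeFactors := Nat.mem_primeFactors.mpr ⟨hp, hpP, hPne⟩
    have hnc : ¬ (p : ℤ) ∣ Fs.content := not_dvd_content hp hpc (hnd₁ p hmem) (hnd₂ p hmem)
    rw [← dvd_add_left hpc, ← hFs_eval, hFb_eval]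
    constructor
    · intro h; exact (Int.Prime.dvd_mul' hp h).resolve_left hnc
    · intro h; exact dvd_mul_of_dvd_right h _
  have hρeq : ∀ p ∈ P.primeFactors, polyRootCountMod ![Fb] p = polyRootCountMod ![F] p := by
    intro p hp
    obtain ⟨hpp, hpd, -⟩ := hprimeP p hp
    exact rootCount_congr fun n => (htrans p hpp hpd n).symm
  -- the sifted sequence
  have hdim : HasSieveDimension (rootDensity Fb) 2 K := hasSieveDimension_rootDensity hω2 hωle
  set x : ℝ := ∑ t ∈ Ioc 0 T, ((Fb.eval (t : ℤ) : ℤ) : ℝ) with hx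
  have hx' : ∀ n ∈ apIndex T 1 0, 0 < Fb.eval (n : ℤ) ∧ ((Fb.eval (n : ℤ) : ℤ) : ℝ) ≤ x := by
    intro n hn
    rw [apIndex_one, Finset.mem_Ioc] at hn
    refine ⟨hFb_pos n hn.1 hn.2, ?_⟩
    rw [hx]
    refine Finset.single_le_sum (f := fun t : ℕ => ((Fb.eval (t : ℤ) : ℤ) : ℝ)) (fun t ht => ?_)
      (Finset.mem_Ioc.mpr hn)
    rw [Finset.mem_Ioc] at ht
    exact_mod_cast (hFb_pos t ht.1 ht.2).le
  have hD1 : (1 : ℝ) < w ^ (19 : ℕ) := one_lt_pow₀ (by linarith) (by norm_num)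
  have hlogD : Real.log (w ^ (19 : ℕ)) = 19 * Real.log w := by
    rw [Real.log_pow]; norm_num
  have hzD : (9 * 2 + 1) * Real.log w ≤ Real.log (w ^ (19 : ℕ)) := by rw [hlogD]; norm_num
  have hX : 0 ≤ (polyAPSeq Fb T 1 0).size x := by
    rw [polyAPSeq_size]; positivity
  have hsift := SieveSequence.sifted_le_of_dvd_primesProdBelow (A := polyAPSeq Fb T 1 0)
    (by rw [polyAPSeq_density]; exact hdim) (by norm_num : (0 : ℝ) < 2) hw hD1 hzD hX hPw
  -- identify the sifted sum with our count
  have hcount : (#((Icc 1 T).filter fun t : ℕ =>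
      ((α₁ * t + β₁) * (α₂ * t + β₂)).natAbs.Coprime P) : ℝ) =
      (polyAPSeq Fb T 1 0).sifted x P := by
    rw [polyAPSeq_sifted Fb T 1 0 hx' P, apIndex_one]
    have hIcc : (Icc 1 T : Finset ℕ) = Ioc 0 T := by
      ext n; simp only [Finset.mem_Icc, Finset.mem_Ioc]; omega
    rw [hIcc]
    congr 2
    refine Finset.filter_congr fun t ht => ?_
    rw [← hFeval]
    exact natAbs_coprime_iff_of_forall fun p hp hpP => htrans p hp hpP t
  -- the main term
  have hmain : (polyAPSeq Fb T 1 0).size x * (polyAPSeq Fb T 1 0).densityProduct P = T * V := by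
    rw [polyAPSeq_size, Nat.cast_one, div_one, SieveSequence.densityProduct, polyAPSeq_density, hV]
    congr 1
    refine Finset.prod_congr rfl fun p hp => ?_
    rw [rootDensity_apply, hρeq p hp]
  have hexp : Real.exp ((9 * 2 + 1) - Real.log (w ^ (19 : ℕ)) / Real.log w) = 1 := by
    rw [hlogD, mul_div_assoc, div_self hlogw.ne']
    norm_num
  -- the remainder sum
  have hrem : ∑ d ∈ P.divisors.filter (fun d : ℕ => (d : ℝ) ≤ w ^ (19 : ℕ)),
      |(polyAPSeq Fb T 1 0).remainder d x| ≤ w ^ (19 : ℕ) * (Real.exp 8 * Real.log w ^ 2) := by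
    calc ∑ d ∈ P.divisors.filter (fun d : ℕ => (d : ℝ) ≤ w ^ (19 : ℕ)),
          |(polyAPSeq Fb T 1 0).remainder d x|
        ≤ ∑ d ∈ P.divisors.filter (fun d : ℕ => (d : ℝ) ≤ w ^ (19 : ℕ)),
          (polyRootCountMod ![Fb] d : ℝ) := by
          refine Finset.sum_le_sum fun d hd => ?_
          have hd0 : 0 < d := Nat.pos_of_mem_divisors (Finset.mem_filter.mp hd).1
          exact abs_remainder_polyAPSeq_le Fb Nat.one_pos hd0 (Nat.coprime_one_left d) hx'
      _ ≤ ∑ d ∈ (primesProdBelow w).divisors.filter (fun d : ℕ => (d : ℝ) ≤ w ^ (19 : ℕ)),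
          (polyRootCountMod ![Fb] d : ℝ) := by
          refine Finset.sum_le_sum_of_subset_of_nonneg ?_ fun d _ _ => Nat.cast_nonneg _
          exact Finset.filter_subset_filter _
            (Nat.divisors_subset_of_dvd (primesProdBelow_ne_zero w) hPw)
      _ ≤ w ^ (19 : ℕ) * (Real.exp 8 * Real.log w ^ 2) :=
          sum_rootCount_divisors_le hωle hw (by positivity)
  -- assemble
  rw [hcount]
  rw [hmain, hexp, mul_one] at hsift
  have hTV : 0 ≤ (T : ℝ) * V := by positivity
  calc (polyAPSeq Fb T 1 0).sifted x P
      ≤ (1 + 2 * K ^ (10 : ℕ)) * (T * V) + w ^ (19 : ℕ) * (Real.exp 8 * Real.log w ^ 2) := by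
        linarith [hsift, hrem]
    _ ≤ (1 + 2 * K ^ (10 : ℕ) + Real.exp 8) * T * V +
        (1 + 2 * K ^ (10 : ℕ) + Real.exp 8) * w ^ (19 : ℕ) * Real.log w ^ 2 := by
        have h1 : (1 + 2 * K ^ (10 : ℕ)) * (T * V) ≤ (1 + 2 * K ^ (10 : ℕ) + Real.exp 8) * T * V := by
          rw [mul_assoc]
          exact mul_le_mul_of_nonneg_right (by linarith [Real.exp_pos 8]) hTV
        have h2 : w ^ (19 : ℕ) * (Real.exp 8 * Real.log w ^ 2) ≤
            (1 + 2 * K ^ (10 : ℕ) + Real.exp 8) * w ^ (19 : ℕ) * Real.log w ^ 2 := by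
          have : w ^ (19 : ℕ) * (Real.exp 8 * Real.log w ^ 2) =
              Real.exp 8 * w ^ (19 : ℕ) * Real.log w ^ 2 := by ring
          rw [this, mul_assoc, mul_assoc]
          refine mul_le_mul_of_nonneg_right ?_ herr0
          have : 0 ≤ 2 * K ^ (10 : ℕ) := by positivity
          linarith
        linarith


/-- **The "Brun–Titchmarsh" form.** With `C₀` as in `card_coprime_le`: if, at the primes of `P`
not dividing an auxiliary `E`, both slopes are invertible and the two roots are distinct
(`p ∤ α₁α₂(α₁β₂ − α₂β₁)`, so `ρ(p) = 2`), while at the primes of `P` dividing `E` the slopes are not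
both divisible by `p` (so `ρ(p) ≥ 1`), then
`#{1 ≤ t ≤ T : ((α₁t+β₁)(α₂t+β₂), P) = 1} ≤ C₀ T ∏_{p ∣ P}(1 − 2/p) ∏_{p ∣ P, p ∣ E} (p−1)/(p−2)
+ C₀ w^{19} log² w`. [cite: HalberstamRichert1974, Thm 2.5] -/
theorem card_coprime_le_generic :
    ∃ C₀ : ℝ, 0 < C₀ ∧ ∀ (α₁ β₁ α₂ β₂ : ℤ) (T : ℕ) (w : ℝ) (P E : ℕ), 2 ≤ w →
      P ∣ primesProdBelow w → Odd P →
      (∀ p ∈ P.primeFactors, ¬ ((p : ℤ) ∣ α₁ ∧ (p : ℤ) ∣ β₁)) →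
      (∀ p ∈ P.primeFactors, ¬ ((p : ℤ) ∣ α₂ ∧ (p : ℤ) ∣ β₂)) →
      (∀ p ∈ P.primeFactors, ¬ p ∣ E →
        ¬ (p : ℤ) ∣ α₁ ∧ ¬ (p : ℤ) ∣ α₂ ∧ ¬ (p : ℤ) ∣ α₁ * β₂ - α₂ * β₁) →
      (∀ p ∈ P.primeFactors, p ∣ E → ¬ ((p : ℤ) ∣ α₁ ∧ (p : ℤ) ∣ α₂)) →
      (∀ t : ℕ, 1 ≤ t → t ≤ T → 0 < α₁ * t + β₁ ∧ 0 < α₂ * t + β₂) →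
      (#((Icc 1 T).filter fun t : ℕ =>
          ((α₁ * t + β₁) * (α₂ * t + β₂)).natAbs.Coprime P) : ℝ) ≤
        C₀ * T * ((∏ p ∈ P.primeFactors, (1 - 2 / (p : ℝ))) *
            ∏ p ∈ P.primeFactors.filter (· ∣ E), (((p : ℝ) - 1) / ((p : ℝ) - 2))) +
          C₀ * w ^ (19 : ℕ) * Real.log w ^ 2 := by
  obtain ⟨C₀, hC₀, h⟩ := card_coprime_le
  refine ⟨C₀, hC₀, ?_⟩
  intro α₁ β₁ α₂ β₂ T w P E hw hPw hPodd hnd₁ hnd₂ hgen hE hpos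
  have hmain := h α₁ β₁ α₂ β₂ T w P hw hPw hPodd hnd₁ hnd₂ hpos
  refine hmain.trans ?_
  suffices hV : ∏ p ∈ P.primeFactors,
      (1 - (polyRootCountMod ![(C α₁ * X + C β₁) * (C α₂ * X + C β₂)] p : ℝ) / p) ≤
      (∏ p ∈ P.primeFactors, (1 - 2 / (p : ℝ))) *
        ∏ p ∈ P.primeFactors.filter (· ∣ E), (((p : ℝ) - 1) / ((p : ℝ) - 2)) by
    have := mul_le_mul_of_nonneg_left hV (by positivity : (0 : ℝ) ≤ C₀ * T)
    linarith
  -- compare the Euler factors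
  have hPne : P ≠ 0 := by rintro rfl; exact (Nat.not_odd_zero hPodd).elim
  have hprimeP : ∀ p ∈ P.primeFactors, p.Prime ∧ p ∣ P ∧ (3 : ℝ) ≤ p := by
    intro p hp
    have hpp := Nat.prime_of_mem_primeFactors hp
    have hpd := Nat.dvd_of_mem_primeFactors hp
    refine ⟨hpp, hpd, ?_⟩
    have h2 : p ≠ 2 := by
      rintro rfl
      exact (Nat.not_even_iff_odd.mpr hPodd) (even_iff_two_dvd.mpr hpd)
    exact_mod_cast (Nat.succ_le_of_lt (lt_of_le_of_ne hpp.two_le (Ne.symm h2)))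
  set ρ : ℕ → ℕ := fun p => polyRootCountMod ![(C α₁ * X + C β₁) * (C α₂ * X + C β₂)] p with hρ
  -- pointwise: `1 - ρ/p ≤ (1 - 2/p) · (if p ∣ E then (p-1)/(p-2) else 1)`
  have hpt : ∀ p ∈ P.primeFactors, (1 - (ρ p : ℝ) / p) ≤
      (1 - 2 / (p : ℝ)) * (if p ∣ E then ((p : ℝ) - 1) / ((p : ℝ) - 2) else 1) := by
    intro p hp
    obtain ⟨hpp, -, hp3⟩ := hprimeP p hp
    have hp0 : (0 : ℝ) < p := by linarith
    by_cases hpE : p ∣ E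
    · rw [if_pos hpE]
      have h1 : (1 : ℝ) ≤ ρ p := by exact_mod_cast one_le_rootCount_pair hpp (hE p hp hpE)
      have heq : (1 - 2 / (p : ℝ)) * (((p : ℝ) - 1) / ((p : ℝ) - 2)) = 1 - 1 / (p : ℝ) := by
        have hp2 : (p : ℝ) - 2 ≠ 0 := by linarith
        field_simp
      rw [heq]
      gcongr
    · rw [if_neg hpE, mul_one]
      obtain ⟨ha1, ha2, hres⟩ := hgen p hp hpE
      rw [show (ρ p : ℝ) = 2 from by rw [hρ]; exact_mod_cast rootCount_pair_eq_two hpp ha1 ha2 hres]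
  have hnonneg : ∀ p ∈ P.primeFactors, 0 ≤ (1 - (ρ p : ℝ) / p) := by
    intro p hp
    obtain ⟨hpp, -, hp3⟩ := hprimeP p hp
    have hρ2 : (ρ p : ℝ) ≤ 2 := by exact_mod_cast rootCount_pair_le_two hpp (hnd₁ p hp) (hnd₂ p hp)
    have hp0 : (0 : ℝ) < p := by linarith
    rw [sub_nonneg, div_le_one hp0]
    linarith
  calc ∏ p ∈ P.primeFactors, (1 - (ρ p : ℝ) / p)
      ≤ ∏ p ∈ P.primeFactors,
          ((1 - 2 / (p : ℝ)) * (if p ∣ E then ((p : ℝ) - 1) / ((p : ℝ) - 2) else 1)) :=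
        Finset.prod_le_prod hnonneg hpt
    _ = (∏ p ∈ P.primeFactors, (1 - 2 / (p : ℝ))) *
          ∏ p ∈ P.primeFactors.filter (· ∣ E), (((p : ℝ) - 1) / ((p : ℝ) - 2)) := by
        rw [Finset.prod_mul_distrib, Finset.prod_ite, Finset.prod_const_one, mul_one]

end PairLinSieve

end Literature.NumberTheory.Sieve
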